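import Summits.Ventures.YMGap.FlowData.TorelonEnergy
import HarnessLib

/-!
# Venture YMGap, track Y3 FLOW-DATA — the centre-flux twists COMMUTE with the tube transfer operator and
# represent `ℤ₂^k`; the sector projections commute with `T` (theorems only)

HONEST FRAMING: venture file of the cell `pub-ymgap` (QuantumFields programme), track Y3; companion THEOREMS for
the definitions files `FlowData/TubeTransferOperator.lean` / `FlowData/TorelonEnergy.lean` (lead R237 (c)).  They
certify that the objects typed there are 't Hooft's flux sectors OF THE TRANSFER OPERATOR: for a central element
`z` the twist isometries `C_s` commute with `T` (`fluxTwistOp_comp_tubeTransferOperator`), hence so do the sector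
projections `P_e` (`tubeFluxProjection_comp_tubeTransferOperator`); for an involution `z² = 1` the map `s ↦ C_s` is a
representation of `ℤ₂^k` by SELF-ADJOINT isometries (`fluxTwistOp_zero`, `fluxTwistOp_comp_fluxTwistOp`,
`isSelfAdjoint_fluxTwistOp`), and consequently (abstract character algebra of `ℤ₂^k`, any family `C` with
`C_{s'} ∘ C_s = C_{s+s'}`, `C_0 = 1`): `C_t ∘ P_e = (−1)^{e·t} P_e` (the range of `P_e` lies in the sector `e`),
`P_e ∘ P_e = P_e`, `Σ_e P_e = 1`, and `P_e` is self-adjoint when the `C_s` are — i.e. the `P_e` are the orthogonal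
projections of 't Hooft's flux decomposition `L² = ⊕_e H_e`, each block invariant under `T`.  Finite spatial torus;
no number, no row, nothing about limits or a mass gap.

References: G. 't Hooft, Nucl. Phys. B 153 (1979) 141 [cite: tHooft1979Flux]; M. Lüscher, Commun. Math. Phys. 54
(1977) 283 [cite: Luscher1977].
-/

noncomputable section

open scoped BigOperators ENNReal
open MeasureTheory Filter Function
open Literature.MathematicalPhysics.QuantumFieldTheory Literature.Analysis.OperatorTheory

namespace Summit.Ventures.YMGap.FlowData

/-! ### Group law of the twists -/

section TwistAlgebra

variable {G : Type*} [Group G] {k L : ℕ}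

/-- For an involution `z² = 1` the prefactors multiply like `ℤ₂^k`:
`p_{s'}(e) · p_s(e) = p_{s + s'}(e)`. [folklore] -/
theorem fluxTwistPrefactor_mul (z : G) (hz : z * z = 1) (s s' : Fin k → ZMod 2) (e : Edge k L) :
    fluxTwistPrefactor z s' e * fluxTwistPrefactor (L := L) z s e = fluxTwistPrefactor z (s + s') e := by
  unfold fluxTwistPrefactor
  simp only [Pi.add_apply]
  rcases ((by decide : ∀ a : ZMod 2, a = 0 ∨ a = 1) (s e.2)) with h | h <;>
    rcases ((by decide : ∀ a : ZMod 2, a = 0 ∨ a = 1) (s' e.2)) with h' | h' <;>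
    by_cases hx : e.1 e.2 = 0 <;>
    simp [h, h', hx, hz]

/-- Twisting by `s` and then by `s'` is twisting by `s + s'` (involution `z`). [folklore] -/
theorem fluxTwist_fluxTwist (z : G) (hz : z * z = 1) (s s' : Fin k → ZMod 2) (a : GaugeConfig k L G) :
    fluxTwist z s' (fluxTwist z s a) = fluxTwist z (s + s') a := by
  funext e
  rw [fluxTwist_apply, fluxTwist_apply, fluxTwist_apply, ← mul_assoc, fluxTwistPrefactor_mul z hz]

/-- The twist by `z⁻¹` undoes the twist by `z`. [folklore] -/
theorem fluxTwist_inv_fluxTwist (z : G) (s : Fin k → ZMod 2) (a : GaugeConfig k L G) :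
    fluxTwist z⁻¹ s (fluxTwist z s a) = a := by
  funext e
  rw [fluxTwist_apply, fluxTwist_apply, ← mul_assoc]
  unfold fluxTwistPrefactor
  split_ifs <;> simp

/-- The twist by `z` undoes the twist by `z⁻¹`. [folklore] -/
theorem fluxTwist_fluxTwist_inv (z : G) (s : Fin k → ZMod 2) (a : GaugeConfig k L G) :
    fluxTwist z s (fluxTwist z⁻¹ s a) = a := by
  simpa only [inv_inv] using fluxTwist_inv_fluxTwist z⁻¹ s a

end TwistAlgebra

/-! ### Character algebra of `ℤ₂^k`: the sector projections are orthogonal idempotents summing to `1` -/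

section Characters

variable {H : Type*} [NormedAddCommGroup H] [InnerProductSpace ℝ H] {k : ℕ}

/-- `s + s = 0` in `ℤ₂^k`. [folklore] -/
theorem add_self_eq_zero_zmod_two (s : Fin k → ZMod 2) : s + s = 0 := by
  funext μ
  rw [Pi.add_apply, Pi.zero_apply]
  rcases ((by decide : ∀ a : ZMod 2, a = 0 ∨ a = 1) (s μ)) with h | h <;> rw [h] <;> decide

/-- The sign character is multiplicative in the twist label: `χ_e(s + t) = χ_e(s) χ_e(t)`. [folklore] -/
theorem fluxSign_add (e s t : Fin k → ZMod 2) : fluxSign e (s + t) = fluxSign e s * fluxSign e t := by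
  unfold fluxSign
  rw [← Finset.prod_mul_distrib]
  refine Finset.prod_congr rfl fun μ _ => ?_
  simp only [Pi.add_apply]
  have h2 : ∀ a : ZMod 2, a = 0 ∨ a = 1 := by decide
  rcases h2 (s μ) with h | h <;> rcases h2 (t μ) with h' | h' <;> rcases h2 (e μ) with he | he <;> simp [h, h', he]

/-- `χ_e(s)² = 1`. [folklore] -/
theorem fluxSign_mul_self (e s : Fin k → ZMod 2) : fluxSign e s * fluxSign e s = 1 := by
  unfold fluxSign
  rw [← Finset.prod_mul_distrib]
  exact Finset.prod_eq_one fun μ _ => by split_ifs <;> norm_num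

/-- Orthogonality of characters, summed over the flux label: `Σ_e χ_e(s) = 2^k` if `s = 0` and `0` otherwise.
[folklore] -/
theorem sum_fluxSign_left (s : Fin k → ZMod 2) :
    ∑ e : Fin k → ZMod 2, fluxSign e s = if s = 0 then (2 : ℝ) ^ k else 0 := by
  classical
  unfold fluxSign
  -- `Σ_e ∏_μ f(e μ, s μ) = ∏_μ Σ_a f(a, s μ)`
  have h := Finset.prod_univ_sum (fun (_ : Fin k) => (Finset.univ : Finset (ZMod 2)))
    (fun μ a => if a = 1 ∧ s μ = 1 then (-1 : ℝ) else 1)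
  rw [Fintype.piFinset_univ] at h
  rw [← h]
  -- each factor is `Σ_{a ∈ ℤ₂} f(a, s μ) = 2` if `s μ = 0`, `0` if `s μ = 1`
  have hfac : ∀ μ : Fin k, (∑ a : ZMod 2, if a = 1 ∧ s μ = 1 then (-1 : ℝ) else 1) =
      if s μ = 1 then 0 else 2 := by
    intro μ
    have huniv : (Finset.univ : Finset (ZMod 2)) = {0, 1} := rfl
    rw [huniv, Finset.sum_pair (by decide)]
    rcases ((by decide : ∀ a : ZMod 2, a = 0 ∨ a = 1) (s μ)) with h0 | h1
    · simp [h0]; norm_num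
    · simp [h1]
  simp_rw [hfac]
  by_cases hs : s = 0
  · subst hs
    simp
  · rw [if_neg hs]
    obtain ⟨μ, hμ⟩ : ∃ μ, s μ ≠ 0 := Function.ne_iff.1 hs
    have hμ1 : s μ = 1 := (((by decide : ∀ a : ZMod 2, a = 0 ∨ a = 1) (s μ))).resolve_left hμ
    exact Finset.prod_eq_zero (Finset.mem_univ μ) (by rw [if_pos hμ1])

variable (C : (Fin k → ZMod 2) → H →L[ℝ] H)

/-- Reindexing the character sum by a shift: `Σ_s χ_e(s) C_{s+t} = χ_e(t) Σ_s χ_e(s) C_s`. [folklore] -/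
theorem sum_fluxSign_smul_shift (e t : Fin k → ZMod 2) :
    ∑ s : Fin k → ZMod 2, fluxSign e s • C (s + t) =
      fluxSign e t • ∑ s : Fin k → ZMod 2, fluxSign e s • C s := by
  rw [Finset.smul_sum]
  refine Fintype.sum_equiv (Equiv.addRight t) _ _ fun s => ?_
  rw [Equiv.coe_addRight, smul_smul, fluxSign_add, ← mul_assoc, mul_comm (fluxSign e t) (fluxSign e s),
    mul_assoc, fluxSign_mul_self, mul_one]

/-- **The range of `P_e` lies in the sector `e`**: for a representation `C` of `ℤ₂^k` (`C_t ∘ C_s = C_{s+t}`),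
`C_t ∘ P_e = χ_e(t) • P_e`; in particular `C_{ê_μ} (P_e ψ) = (−1)^{e_μ} P_e ψ`. [cite: tHooft1979Flux] -/
theorem comp_fluxProjection (hC : ∀ s t : Fin k → ZMod 2, (C t).comp (C s) = C (s + t))
    (e t : Fin k → ZMod 2) : (C t).comp (fluxProjection C e) = fluxSign e t • fluxProjection C e := by
  unfold fluxProjection
  rw [ContinuousLinearMap.comp_smul, ContinuousLinearMap.comp_finsetSum, smul_comm]
  congr 1
  simp_rw [ContinuousLinearMap.comp_smul, hC]
  exact sum_fluxSign_smul_shift C e t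

/-- Composition formula: `P_e ∘ X = 2^{−k} Σ_s χ_e(s) (C_s ∘ X)`. [folklore] -/
theorem fluxProjection_comp (e : Fin k → ZMod 2) (X : H →L[ℝ] H) :
    (fluxProjection C e).comp X = ((2 : ℝ) ^ k)⁻¹ • ∑ s : Fin k → ZMod 2, fluxSign e s • (C s).comp X := by
  unfold fluxProjection
  rw [ContinuousLinearMap.smul_comp, ContinuousLinearMap.finsetSum_comp]
  simp_rw [ContinuousLinearMap.smul_comp]

/-- **`P_e` is idempotent** for a representation `C` of `ℤ₂^k`. [folklore] -/
theorem fluxProjection_comp_self (hC : ∀ s t : Fin k → ZMod 2, (C t).comp (C s) = C (s + t))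
    (e : Fin k → ZMod 2) : (fluxProjection C e).comp (fluxProjection C e) = fluxProjection C e := by
  rw [fluxProjection_comp]
  simp_rw [comp_fluxProjection C hC, smul_smul, fluxSign_mul_self, one_smul, Finset.sum_const, Finset.card_univ]
  rw [← Nat.cast_smul_eq_nsmul ℝ, smul_smul]
  have h2k : (2 : ℝ) ^ k ≠ 0 := by positivity
  have hcard : ((Fintype.card (Fin k → ZMod 2) : ℕ) : ℝ) = (2 : ℝ) ^ k := by
    simp [ZMod.card, Fintype.card_fin]
  rw [hcard, inv_mul_cancel₀ h2k, one_smul]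

/-- **The sector projections sum to the identity** when `C_0 = 1`: `Σ_e P_e = 1` (orthogonality of characters).
[folklore] -/
theorem sum_fluxProjection (hC0 : C 0 = 1) : ∑ e : Fin k → ZMod 2, fluxProjection C e = 1 := by
  unfold fluxProjection
  rw [← Finset.smul_sum, Finset.sum_comm]
  simp_rw [← Finset.sum_smul, sum_fluxSign_left, ite_smul, zero_smul, Finset.sum_ite_eq', Finset.mem_univ,
    if_true, hC0, smul_smul]
  have h2k : (2 : ℝ) ^ k ≠ 0 := by positivity
  rw [inv_mul_cancel₀ h2k, one_smul]

/-- **`P_e` is self-adjoint** when every `C_s` is (real coefficients). [folklore] -/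
theorem isSelfAdjoint_fluxProjection [CompleteSpace H] (hC : ∀ s, IsSelfAdjoint (C s)) (e : Fin k → ZMod 2) :
    IsSelfAdjoint (fluxProjection C e) := by
  unfold fluxProjection
  refine IsSelfAdjoint.smul (IsSelfAdjoint.all _) ?_
  induction (Finset.univ : Finset (Fin k → ZMod 2)) using Finset.induction_on with
  | empty => rw [Finset.sum_empty]; exact IsSelfAdjoint.zero _
  | insert a t hat ih =>
    rw [Finset.sum_insert hat]
    exact IsSelfAdjoint.add (IsSelfAdjoint.smul (IsSelfAdjoint.all _) (hC a)) ih

end Characters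

/-! ### The twist operators represent `ℤ₂^k` -/

section TwistOps

variable {G : Type*} [Group G] [TopologicalSpace G] [IsTopologicalGroup G] [CompactSpace G]
  [MeasurableSpace G] [BorelSpace G] {k L : ℕ} [NeZero L]

/-- **No twist is the identity operator**: `C_0 = 1`. [folklore] -/
theorem fluxTwistOp_zero (z : G) : fluxTwistOp k L z (0 : Fin k → ZMod 2) = 1 := by
  refine ContinuousLinearMap.ext fun ψ => Lp.ext ?_
  refine (fluxTwistOp_ae_eq z 0 ψ).trans ?_
  rw [fluxTwist_zero]
  exact Eventually.of_forall fun a => rfl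

/-- **Group law**: `C_{s'} ∘ C_s = C_{s + s'}` for an involution `z² = 1` — `s ↦ C_s` is a representation of
`ℤ₂^k` by isometries. [cite: tHooft1979Flux] -/
theorem fluxTwistOp_comp_fluxTwistOp (z : G) (hz : z * z = 1) (s s' : Fin k → ZMod 2) :
    (fluxTwistOp k L z s').comp (fluxTwistOp k L z s) = fluxTwistOp k L z (s + s') := by
  refine ContinuousLinearMap.ext fun ψ => Lp.ext ?_
  rw [ContinuousLinearMap.comp_apply]
  refine (fluxTwistOp_ae_eq z s' (fluxTwistOp k L z s ψ)).trans ?_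
  -- `(C_s ψ) ∘ twist_{s'} =ᵐ (ψ ∘ twist_s) ∘ twist_{s'} = ψ ∘ twist_{s+s'}`
  have h1 : ((fluxTwistOp k L z s ψ : GaugeConfig k L G → ℝ) ∘ fluxTwist z s') =ᵐ[sliceMeasure G k L]
      (((ψ : GaugeConfig k L G → ℝ) ∘ fluxTwist z s) ∘ fluxTwist z s') :=
    (measurePreserving_fluxTwist (L := L) z s').quasiMeasurePreserving.ae_eq_comp (fluxTwistOp_ae_eq z s ψ)
  refine h1.trans ((fluxTwistOp_ae_eq z (s + s') ψ).trans ?_).symm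
  refine Eventually.of_forall fun a => ?_
  simp only [Function.comp_apply]
  rw [fluxTwist_fluxTwist z hz s' s, add_comm]

/-- `C_s ∘ C_s = 1` for an involution `z² = 1`. [folklore] -/
theorem fluxTwistOp_comp_self (z : G) (hz : z * z = 1) (s : Fin k → ZMod 2) :
    (fluxTwistOp k L z s).comp (fluxTwistOp k L z s) = 1 := by
  rw [fluxTwistOp_comp_fluxTwistOp z hz]
  have hs : s + s = 0 := by
    funext μ
    rw [Pi.add_apply, Pi.zero_apply]
    rcases ((by decide : ∀ a : ZMod 2, a = 0 ∨ a = 1) (s μ)) with h | h <;> rw [h] <;> decide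
  rw [hs, fluxTwistOp_zero]

/-- **`C_s` is self-adjoint** for an involution `z² = 1`: `⟪C_s φ, ψ⟫ = ∫ φ(twist a) ψ(a) da =
∫ φ(b) ψ(twist b) db` (change of variables `a = twist b`, a measure-preserving involution). [folklore] -/
theorem isSelfAdjoint_fluxTwistOp (z : G) (hz : z * z = 1) (s : Fin k → ZMod 2) :
    IsSelfAdjoint (fluxTwistOp k L z s) := by
  set μ : Measure (GaugeConfig k L G) := sliceMeasure G k L with hμ
  have hmp : MeasurePreserving (fluxTwist (L := L) z s) μ μ := measurePreserving_fluxTwist z s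
  rw [ContinuousLinearMap.isSelfAdjoint_iff_isSymmetric]
  intro φ ψ
  change @inner ℝ _ _ (fluxTwistOp k L z s φ) ψ = @inner ℝ _ _ φ (fluxTwistOp k L z s ψ)
  rw [inner_eq_integral, inner_eq_integral]
  have h1 : ∫ a, (fluxTwistOp k L z s φ : GaugeConfig k L G → ℝ) a * ψ a ∂μ =
      ∫ a, φ (fluxTwist z s a) * ψ a ∂μ := by
    refine integral_congr_ae ?_
    filter_upwards [fluxTwistOp_ae_eq (L := L) z s φ] with a ha
    rw [ha, Function.comp_apply]
  have h2 : ∫ a, φ a * (fluxTwistOp k L z s ψ : GaugeConfig k L G → ℝ) a ∂μ =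
      ∫ a, φ a * ψ (fluxTwist z s a) ∂μ := by
    refine integral_congr_ae ?_
    filter_upwards [fluxTwistOp_ae_eq (L := L) z s ψ] with a ha
    rw [ha, Function.comp_apply]
  rw [h1, h2]
  -- change of variables `a = twist b` in the first integral
  have hg : AEStronglyMeasurable (fun a => φ a * ψ (fluxTwist z s a)) μ :=
    (Lp.aestronglyMeasurable φ).mul
      ((Lp.aestronglyMeasurable ψ).comp_quasiMeasurePreserving hmp.quasiMeasurePreserving)
  have hg' : AEStronglyMeasurable (fun a => φ a * ψ (fluxTwist z s a)) (Measure.map (fluxTwist (L := L) z s) μ) := by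
    rw [hmp.map_eq]; exact hg
  have h3 := integral_map hmp.measurable.aemeasurable hg'
  rw [hmp.map_eq] at h3
  -- `h3 : ∫ (φ a * ψ (twist a)) = ∫ (φ (twist b) * ψ (twist (twist b)))`
  rw [h3]
  refine integral_congr_ae (Eventually.of_forall fun b => ?_)
  dsimp only
  rw [fluxTwist_fluxTwist_of_mul_self z hz]

end TwistOps

/-! ### The twists and the sector projections commute with the transfer operator -/

section Commute

variable {G : Type*} [Group G] [TopologicalSpace G] [IsTopologicalGroup G] [CompactSpace G]
  [MeasurableSpace G] [BorelSpace G] [SecondCountableTopology G] {n : ℕ} (ρ : G →* Matrix (Fin n) (Fin n) ℂ)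
  (J : ℝ) {k L : ℕ} [NeZero L]

/-- **The twists commute with the transfer operator** for central `z`: `C_s ∘ T = T ∘ C_s`.  Both sides have the
kernel `(a, b) ↦ K(fluxTwist a, b)`: on the left by composing the kernel formula with the measure-preserving twist,
on the right by the twist invariance `K(a, b) = K(twist a, twist b)` and the change of variables `b ↦ twist b`.
[cite: tHooft1979Flux] -/
theorem fluxTwistOp_comp_tubeTransferOperator (hρ : Continuous ρ) {z : G} (hz : z ∈ Subgroup.center G)
    (s : Fin k → ZMod 2) :
    (fluxTwistOp k L z s).comp (tubeTransferOperator ρ J k L) =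
      (tubeTransferOperator ρ J k L).comp (fluxTwistOp k L z s) := by
  set μ : Measure (GaugeConfig k L G) := sliceMeasure G k L with hμ
  set K : GaugeConfig k L G → GaugeConfig k L G → ℝ := sliceKernel (d := k) (L := L) ρ J J with hK
  have hmp : MeasurePreserving (fluxTwist (L := L) z s) μ μ := measurePreserving_fluxTwist z s
  have hKc : Continuous (uncurry K) := continuous_sliceKernel (d := k) (L := L) ρ hρ J J
  refine ContinuousLinearMap.ext fun φ => Lp.ext ?_
  rw [ContinuousLinearMap.comp_apply, ContinuousLinearMap.comp_apply]
  -- left-hand side: `C_s (T φ) =ᵐ fun a => ∫ K (twist a) b φ b`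
  have hL : (fluxTwistOp k L z s (tubeTransferOperator ρ J k L φ) : GaugeConfig k L G → ℝ) =ᵐ[μ]
      fun a => ∫ b, K (fluxTwist z s a) b * φ b ∂μ := by
    refine (fluxTwistOp_ae_eq z s _).trans ?_
    exact hmp.quasiMeasurePreserving.ae_eq_comp (tubeTransferOperator_ae_eq J k L hρ φ)
  -- right-hand side: `T (C_s φ) =ᵐ fun a => ∫ K a b φ (twist b) = ∫ K (twist a) c φ c`
  have hR : (tubeTransferOperator ρ J k L (fluxTwistOp k L z s φ) : GaugeConfig k L G → ℝ) =ᵐ[μ]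
      fun a => ∫ b, K (fluxTwist z s a) b * φ b ∂μ := by
    refine (tubeTransferOperator_ae_eq J k L hρ _).trans (Eventually.of_forall fun a => ?_)
    have hcs := fluxTwistOp_ae_eq (L := L) z s φ
    -- replace `C_s φ` by `φ ∘ twist` under the integral
    have h1 : ∫ b, K a b * (fluxTwistOp k L z s φ : GaugeConfig k L G → ℝ) b ∂μ =
        ∫ b, K a b * φ (fluxTwist z s b) ∂μ := by
      refine integral_congr_ae ?_
      filter_upwards [hcs] with b hb
      rw [hb, Function.comp_apply]
    -- twist invariance of the kernel and the change of variables
    have h2 : ∫ b, K a b * φ (fluxTwist z s b) ∂μ =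
        ∫ b, (fun c => K (fluxTwist z s a) c * φ c) (fluxTwist z s b) ∂μ := by
      refine integral_congr_ae (Eventually.of_forall fun b => ?_)
      simp only [hK, sliceKernel_fluxTwist ρ hz]
    have hg : AEStronglyMeasurable (fun c => K (fluxTwist z s a) c * φ c) μ :=
      ((hKc.comp (Continuous.prodMk continuous_const continuous_id)).aestronglyMeasurable).mul
        (Lp.aestronglyMeasurable φ)
    have h3 : ∫ b, (fun c => K (fluxTwist z s a) c * φ c) (fluxTwist z s b) ∂μ =
        ∫ c, K (fluxTwist z s a) c * φ c ∂μ := by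
      have hg' : AEStronglyMeasurable (fun c => K (fluxTwist z s a) c * φ c)
          (Measure.map (fluxTwist (L := L) z s) μ) := by rw [hmp.map_eq]; exact hg
      have := integral_map hmp.measurable.aemeasurable hg'
      rw [hmp.map_eq] at this
      exact this.symm
    dsimp only
    rw [h1, h2, h3]
  exact hL.trans hR.symm

/-- **The sector projections commute with the transfer operator** (central `z`): `P_e ∘ T = T ∘ P_e`, so that
`T ∘ P_e` is `T` restricted to the flux sector `e` (and `0` on its complement). [cite: tHooft1979Flux] -/
theorem tubeFluxProjection_comp_tubeTransferOperator (hρ : Continuous ρ) {z : G} (hz : z ∈ Subgroup.center G)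
    (e : Fin k → ZMod 2) :
    (tubeFluxProjection z k L e).comp (tubeTransferOperator ρ J k L) =
      (tubeTransferOperator ρ J k L).comp (tubeFluxProjection z k L e) := by
  unfold tubeFluxProjection fluxProjection
  rw [ContinuousLinearMap.smul_comp, ContinuousLinearMap.comp_smul, ContinuousLinearMap.finsetSum_comp,
    ContinuousLinearMap.comp_finsetSum]
  congr 1
  refine Finset.sum_congr rfl fun s _ => ?_
  rw [ContinuousLinearMap.smul_comp, ContinuousLinearMap.comp_smul,
    fluxTwistOp_comp_tubeTransferOperator ρ J hρ hz s]

end Commute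

/-! ### The tube's sector projections: eigen-relation, idempotency, completeness, self-adjointness -/

section TubeProjections

variable {G : Type*} [Group G] [TopologicalSpace G] [IsTopologicalGroup G] [CompactSpace G]
  [MeasurableSpace G] [BorelSpace G] {k L : ℕ} [NeZero L] (z : G) (hz : z * z = 1)
include hz

/-- `C_t (P_e ψ) = (−1)^{e·t} P_e ψ`: the range of the tube's `P_e` lies in the flux sector `e`.
[cite: tHooft1979Flux] -/
theorem fluxTwistOp_comp_tubeFluxProjection (e t : Fin k → ZMod 2) :
    (fluxTwistOp k L z t).comp (tubeFluxProjection z k L e) = fluxSign e t • tubeFluxProjection z k L e :=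
  comp_fluxProjection (fluxTwistOp k L z) (fun s t => fluxTwistOp_comp_fluxTwistOp z hz s t) e t

/-- The tube's `P_e` is idempotent. [folklore] -/
theorem tubeFluxProjection_comp_self (e : Fin k → ZMod 2) :
    (tubeFluxProjection z k L e).comp (tubeFluxProjection z k L e) = tubeFluxProjection z k L e :=
  fluxProjection_comp_self (fluxTwistOp k L z) (fun s t => fluxTwistOp_comp_fluxTwistOp z hz s t) e

/-- The tube's `P_e` is self-adjoint. [folklore] -/
theorem isSelfAdjoint_tubeFluxProjection (e : Fin k → ZMod 2) : IsSelfAdjoint (tubeFluxProjection z k L e) :=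
  isSelfAdjoint_fluxProjection (fluxTwistOp k L z) (fun s => isSelfAdjoint_fluxTwistOp z hz s) e

omit hz in
/-- The tube's sector projections sum to the identity: `Σ_e P_e = 1`. [folklore] -/
theorem sum_tubeFluxProjection : ∑ e : Fin k → ZMod 2, tubeFluxProjection z k L e = 1 :=
  sum_fluxProjection (fluxTwistOp k L z) (fluxTwistOp_zero z)

end TubeProjections

end Summit.Ventures.YMGap.FlowData
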